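import Mathlib
import Literature.Probability.LatticeModels.BrillouinRiemannSumRate

/-!
# Momentum averages over the torus grid converge for EVERY side `L`, uniformly in a compact parameter

Topic `Probability/LatticeModels`; companion of `BrillouinRiemannSumUniform.lean`, whose
`momentumAverage_uniform_approx` («`L^{-d} Σ_k G(2πk/L, y) → (2π)^{-d} ∫_{[-π,π]^d} G(·, y)` uniformly
in `y ∈ C`») is stated for EVEN sides `L` only (it identifies the momentum grid with the corner grid
of `[-π,π)^d` through the half-period shift `k ↦ k + (L/2,…,L/2)`, which needs `2 ∣ L`) and for a
`2π`-periodic integrand.  With the parity-free shift identity of `BrillouinRiemannSumRate.lean`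
(`momentumAverage_eq_smul_cornerRiemannSum_shift`: `L^{-d} Σ_k G(2πk/L) = (2π)^{-d}·δ^d Σ_j G(c_j + π)`
for EVERY `L ≥ 1`) and its grid-scale modulus estimate
(`norm_momentumAverage_sub_integral_le_of_modulus`), the same convergence holds along ALL sides and
without periodicity, the limit being written with the shifted integrand `∫_{[-π,π]^d} G(q + π) dq`
(`= ∫_{[0,2π]^d} G`; for a `2π`-periodic `G` also `= ∫_{[-π,π]^d} G`).  This is the form in which
volume limits «eventually in `L`» (all large `L`, not all large even `L`) are consumed, e.g. by the
volume-limit slot `FinalTwoLegVolLimit` of the Hubbard KL programme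
(`Summits/HubbardSuperconductivity/…/KLProgrammeKLRegimeVolumeLimitDefs`).  PROVED here:

* `momentumAverage_uniform_approx_allSides` — for `G(p, y)` jointly continuous on `[0,2π]^d × C`,
  `C` compact, and `ε > 0`: there is `L₀` with
  `‖L^{-d} Σ_{k ∈ (ℤ/Lℤ)^d} G(2πk/L, y) - (2π)^{-d} ∫_{[-π,π]^d} G(q + π, y) dq‖ ≤ ε` for ALL `L ≥ L₀`
  and all `y ∈ C` (uniform continuity on the compact product gives one grid-scale modulus for all `y`);
* `momentumAverage_approx_allSides` — the parameter-free case.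

Everything is proved; no definitions.

## References

* G. Benfatto, A. Giuliani, V. Mastropietro, Ann. Henri Poincaré 7 (2006) 809–898, eqs. (1.4), (2.4)
  (the finite-volume free propagator «in the limit `L → ∞`», uniformly in the external arguments).
  [BenfattoGiulianiMastropietro2006]
* S. Friedli, Y. Velenik, *Statistical Mechanics of Lattice Systems* (CUP 2017), §10.5.2, (10.41).
  [FriedliVelenikSMLS2017]
* W. Rudin, *Principles of Mathematical Analysis*, 3rd ed., Thm. 7.9 / 6.8 (uniform continuity on a
  compact set and Riemann sums). [Rudin1976]
-/

noncomputable section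

namespace Literature.Probability.LatticeModels

open MeasureTheory Finset Real

variable {d : ℕ} {E : Type*} [NormedAddCommGroup E] [NormedSpace ℝ E] [CompleteSpace E]
  {Y : Type*} [PseudoMetricSpace Y]

/-- **Momentum averages converge to zone averages along ALL sides, uniformly in a compact
parameter.** For `G(p, y)` jointly continuous on `[0,2π]^d × C` (`C` compact) and `ε > 0` there is
`L₀` such that for every side `L ≥ L₀` and every `y ∈ C`,
`‖L^{-d} Σ_{k ∈ (ℤ/Lℤ)^d} G(2πk/L, y) - (2π)^{-d} ∫_{[-π,π]^d} G(q + π, y) dq‖ ≤ ε`.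
[cite: BenfattoGiulianiMastropietro2006, eqs. (1.4) (2.4)] -/
theorem momentumAverage_uniform_approx_allSides {C : Set Y} (hC : IsCompact C)
    {G : (Fin d → ℝ) → Y → E}
    (hG : ContinuousOn (fun q : (Fin d → ℝ) × Y => G q.1 q.2)
      ((Set.pi Set.univ fun _ : Fin d => Set.Icc (0 : ℝ) (2 * π)) ×ˢ C))
    {ε : ℝ} (hε : 0 < ε) :
    ∃ L₀ : ℕ, ∀ (L : ℕ) [NeZero L], L₀ ≤ L → ∀ y ∈ C,
      ‖((L ^ d : ℕ) : ℝ)⁻¹ • ∑ k : TorusSite d L, G (latticeMomentum L k) y -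
          ((2 * π) ^ d)⁻¹ • ∫ q in brillouin d, G (fun i => q i + π) y‖ ≤ ε := by
  set A : Set (Fin d → ℝ) := Set.pi Set.univ fun _ : Fin d => Set.Icc (0 : ℝ) (2 * π) with hAdef
  have hA : IsCompact A := isCompact_univ_pi fun _ => isCompact_Icc
  have huc : UniformContinuousOn (fun q : (Fin d → ℝ) × Y => G q.1 q.2) (A ×ˢ C) :=
    (hA.prod hC).uniformContinuousOn_of_continuous hG
  obtain ⟨η, hη, hηG⟩ := Metric.uniformContinuousOn_iff.1 huc ε hε
  obtain ⟨N, hN⟩ := exists_nat_gt (2 * π / η)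
  refine ⟨max N 1, fun L _ hL y hy => ?_⟩
  have hL1 : 1 ≤ L := le_of_max_le_right hL
  have hLpos : (0 : ℝ) < L := by exact_mod_cast hL1
  have hδη : gridStep L < η := by
    have hNL : (N : ℝ) ≤ L := by exact_mod_cast le_of_max_le_left hL
    unfold gridStep
    rw [div_lt_iff₀ hLpos]
    calc 2 * π = 2 * π / η * η := by field_simp
      _ < N * η := by gcongr
      _ ≤ L * η := by gcongr
      _ = η * L := mul_comm _ _
  -- the slice `G(·, y)` is continuous on the cube
  have hGy : ContinuousOn (fun p => G p y) A := by
    have h1 : ContinuousOn (fun p : Fin d → ℝ => (p, y)) A :=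
      continuousOn_id.prodMk continuousOn_const
    exact hG.comp h1 fun p hp => Set.mk_mem_prod hp hy
  refine norm_momentumAverage_sub_integral_le_of_modulus hGy fun p hp q hq hpq => ?_
  have hpq' : dist ((p, y) : (Fin d → ℝ) × Y) (q, y) < η := by
    rw [Prod.dist_eq, dist_self, max_eq_left dist_nonneg]
    exact hpq.trans_lt hδη
  rw [← dist_eq_norm]
  exact (hηG (p, y) (Set.mk_mem_prod hp hy) (q, y) (Set.mk_mem_prod hq hy) hpq').le

omit [PseudoMetricSpace Y] in
/-- **Momentum averages of a continuous function converge to its zone average along ALL sides**: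
for `G` continuous on `[0,2π]^d` and `ε > 0` there is `L₀` with
`‖L^{-d} Σ_{k ∈ (ℤ/Lℤ)^d} G(2πk/L) - (2π)^{-d} ∫_{[-π,π]^d} G(q + π) dq‖ ≤ ε` for every side `L ≥ L₀`.
[cite: FriedliVelenikSMLS2017, §10.5.2 (10.41)] -/
theorem momentumAverage_approx_allSides {G : (Fin d → ℝ) → E}
    (hG : ContinuousOn G (Set.pi Set.univ fun _ : Fin d => Set.Icc (0 : ℝ) (2 * π)))
    {ε : ℝ} (hε : 0 < ε) :
    ∃ L₀ : ℕ, ∀ (L : ℕ) [NeZero L], L₀ ≤ L →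
      ‖((L ^ d : ℕ) : ℝ)⁻¹ • ∑ k : TorusSite d L, G (latticeMomentum L k) -
          ((2 * π) ^ d)⁻¹ • ∫ q in brillouin d, G (fun i => q i + π)‖ ≤ ε := by
  have hG' : ContinuousOn (fun q : (Fin d → ℝ) × Unit => G q.1)
      ((Set.pi Set.univ fun _ : Fin d => Set.Icc (0 : ℝ) (2 * π)) ×ˢ (Set.univ : Set Unit)) :=
    hG.comp continuousOn_fst fun q hq => (Set.mem_prod.1 hq).1
  obtain ⟨L₀, hL₀⟩ := momentumAverage_uniform_approx_allSides (G := fun p (_ : Unit) => G p)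
    isCompact_univ hG' hε
  exact ⟨L₀, fun L _ hL => hL₀ L hL () (Set.mem_univ _)⟩

end Literature.Probability.LatticeModels

end
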